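import Summits.ResolutionOfSingularities.ResolutionOfSingularities.Theorems.EquisingularLiftEquisingularLiftNatTowerBTransportFour
import Summits.ResolutionOfSingularities.ResolutionOfSingularities.Theorems.EquisingularLiftEquisingularLiftNatTowerPtStepsInvThree
import HarnessLib

/-!
# [OURS · L1 W4.5(b) · EL♮(3) · T23-A‴] THE POINT STEPS ON `Tower.InvB₄` (model-carrying list `Es`, model-less list `Ns`): the centre-agnostic core
# `Tower.invB₄_pointStep` + the explicit-stage `(pt-reg)` / `(pt-ram)` steps (brick (U2)′, over res-L1-w45b-stub-2's `Exc₄` transport layer …NatTowerBTransportFour p625145)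
# `Tower.invB₄_ptRegStep` (the NEW plane RETAINED WITH ITS MODEL, res-L1-w45b-stub-2's `Tower.exists_ptReg_stage_planeModel` p624223) / `Tower.invB₄_ptRamStep`
# — brick (U2)′ of res-L1-w45b-stub-4's T23-A‴ ENGINE WORD v1 (draft 3dcf936910c4d869 §3), over (U1) `…NatTowerInvBFourDefs`

res-type-027 g18 ((U2)′ holder per desk (A′)/CHAIN v7.52–53 and stub-4 / stub-2's lines 2026-08-28T10:14–10:19Z). Crux `EquisingularLiftNatThree` =
stmt-ResolutionOfSingularities-20148 (parent stmt-…-20038), route `EquisingularLift`, line `sections`. OURS; NOT a statement of any manuscript ([Hironaka2017]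
is a candidate under adjudication, nothing of it is asserted); AI-written, weaker than expert review. DEF-FREE; no `sorry`; standard axioms;
`--supports stmt-ResolutionOfSingularities-20148 --as helper`; closes nothing by itself.

WHAT (the ₄ twins of res-L1-w45b-stub-4's …NatTowerBPointSteps, over res-L1-w45b-stub-2's `Exc₄` transports `Tower.exc₄_shadow_of_disjoint` /
`Tower.exc₄_transport_away` / `Tower.exc₄_pointCentre_transport` (…NatTowerBTransportFour p625145)):
* **`Tower.invB₄_pointStep`** — the centre-agnostic core at an explicit stage step: `K'` menu as in B; `E'` = the NEW plane WITH A SUPPLIED `Exc₄` datum in the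
  new stage, or `St E` with `pt ∉ E`; `Es'` ∋ B-AWAY transports of members of `E :: Es` off `pt`, or the new plane with its datum; `Ns'` ∋ model-less transports
  `St F` of any `F ∈ E :: Es ++ Ns` (topology: `IsClosed` + `not_closure_preimage_diff_subset`), or the new (possibly fat) plane;
* **`Tower.invB₄_ptRegStep`** — the `(pt-reg)` step from `Tower.InvB₄ … G γ T E Es Ns K` at a closed point of `T̃` where `G` is regular: stage + plane model by
  res-L1-w45b-stub-2's `Tower.exists_ptReg_stage_planeModel` (p624223; plane model = res-L1-w45b-lead-1's `pointPlane_model` p623734 / `comap_vanishingIdeal_singleton_eq…`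
  p616407); the new plane's ruled datum is the stand-in `hRuledBirth` (at `FE` it is the package's flatness clause, `Tower.invB₄_ptRegStep_FE`-style one-liner for
  the assembler); **`Tower.invB₄_ptRamStep`** — the `(pt-ram)` step (`fatPointStep_model`, res-L1-w45b-stub-4 …NatTowerPtStepsInvThree): the FAT plane has no
  reduced model and may enter `Ns'` only; the running surface is transported off the point.
The downstairs step predicates `TowerPtRegB₄` / `TowerPtRamB₄` ((D‴2)/(D‴3), text owner res-L1-w45b-lead-2) are NOT consumed here: once typed, the two driver
clauses are three-line wrappers over `Tower.invB₄_ptRegStep` / `Tower.invB₄_ptRamStep` (their menus are sub-menus of the cores').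

References: Q. Liu, *Algebraic Geometry and Arithmetic Curves* (2002), §8.1, Thm. 8.1.19 [Liu2002]; U. Görtz, T. Wedhorn, *Algebraic Geometry I* (2020),
Prop. 13.91 (3), (13.19) [GortzWedhorn2020]; The Stacks Project, Tags 01WS, 02OS, 033B [StacksProject] — through the cited tree files.
-/

set_option linter.dupNamespace false -- mandated namespace `Summit.<Summit>.<Problem>` of this single-conjunct summit
set_option linter.overlappingInstances false -- the binders carry `[IsDomain O] [IsDiscreteValuationRing O]`

noncomputable section

open CategoryTheory CategoryTheory.Limits AlgebraicGeometry TopologicalSpace Topology IsLocalRing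
open Literature.AlgebraicGeometry.Resolution
open AlgebraicGeometry.Scheme.IdealSheafData
open Summit.ResolutionOfSingularities.ResolutionOfSingularities.Theses.EquisingularLift.Split
open Summit.ResolutionOfSingularities.ResolutionOfSingularities.Cruxes.EquisingularLift.StrataSplit

namespace Summit.ResolutionOfSingularities.ResolutionOfSingularities.Cruxes.EquisingularLiftNat.Sections

/-! ## The centre-agnostic core on `Tower.InvB₄` -/

section PointStepCore4

variable (O : Type) [CommRing O] (k : Type) [Field k] (θ : O →+* k) (P : Scheme.{0}) (q : P ⟶ Spec (.of O)) (Y : Set P)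
  (Ch : ∀ X' : Scheme.{0}, (X' ⟶ P) → Set X' → Prop) (Ruled : Tower.RuledDatum P)
  {F₉ : Scheme.{0}} {Z₉ : Set F₉} {hZ₉ : IsClosed Z₉} {F₁₀ : Scheme.{0}} {υ' : F₁₀ ⟶ F₉}
  -- an ISO-INVARIANT ruled datum (the engine's `FE` = O-flatness of `V(𝓔)` is one)
  (hRuledIso : ∀ (G₀ G₀' : Scheme.{0}) (γ₀ : G₀ ⟶ F₁₀) (γ₀' : G₀' ⟶ F₁₀) (E₀ : Set G₀) (E₀' : Set G₀') (X₀ X₀'' : Scheme.{0})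
      (σ₀ : X₀ ⟶ P) (j₀ : G₀ ⟶ X₀) (j₀' : G₀' ⟶ X₀'') (𝓔₀ : X₀.IdealSheafData) (τ₀ : X₀'' ⟶ X₀),
    (∃ e : (𝓔₀.comap τ₀).subscheme ≅ 𝓔₀.subscheme, e.hom ≫ 𝓔₀.subschemeι = (𝓔₀.comap τ₀).subschemeι ≫ τ₀) →
    Ruled F₉ Z₉ hZ₉ F₁₀ υ' G₀ γ₀ E₀ X₀ σ₀ j₀ 𝓔₀ → Ruled F₉ Z₉ hZ₉ F₁₀ υ' G₀' γ₀' E₀' X₀'' (τ₀ ≫ σ₀) j₀' (𝓔₀.comap τ₀))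
  {G G' X X'' : Scheme.{0}} {γ : G ⟶ F₁₀} {T E : Set G} {Es : List (Set G)} {K : Set G}
  -- the old invariant, unpacked
  (hυ' : IsBlowup υ' (vanishingIdeal (⟨Z₉, hZ₉⟩ : Closeds F₉))) (hZ₉inf : Z₉.Infinite)
  {Ns : List (Set G)}
  (hTirr : IsIrreducible T) (hEcl : IsClosed E) (hTE : ¬ T ⊆ E) (hEsB : ∀ F ∈ Es, IsClosed F ∧ ¬ T ⊆ F)
  (hNsB : ∀ F ∈ Ns, IsClosed F ∧ ¬ T ⊆ F)
  {σ : X ⟶ P} {jG : G ⟶ X}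
  (hExc : ∀ hE : IsClosed E, Tower.Exc₄ O P q Y Ruled Z₉ hZ₉ υ' G γ E hE K X σ jG)
  (hExcF : ∀ F ∈ Es, ∀ hF : IsClosed F, Tower.Exc₄ O P q Y Ruled Z₉ hZ₉ υ' G γ F hF ∅ X σ jG)
  -- the point, the downstairs centre and its blow-up
  {pt : G} (hyc : IsClosed ({pt} : Set G)) (hTy : ¬ T ⊆ {pt}) {D : G.IdealSheafData} (hD : (D.support : Set G) = {pt})
  {υ₂ : G' ⟶ G} (hυ₂ : IsBlowup υ₂ D) [IsLocallyNoetherian G] [IsLocallyNoetherian X] [IsLocallyNoetherian X'']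
  -- the upstairs blow-up: any centre missing every closed subscheme not through `jG pt`
  {τ : X'' ⟶ X} {C : X.IdealSheafData} (hτ : IsBlowup τ C)
  (hdisj : ∀ I : X.IdealSheafData, jG pt ∉ (I.support : Set X) → Disjoint (I.support : Set X) (C.support : Set X))
  -- the model square and the new stage
  {j₂ : G' ⟶ X''} {t₂ : G' ⟶ Spec (.of k)} (hcomm : j₂ ≫ τ = υ₂ ≫ jG)
  {S'' : Set X''} (hCh'' : Ch X'' (τ ≫ σ) S'') [IsIntegral X''] (hX''reg : Scheme.IsRegular X'') (hdom'' : IsDominant ((τ ≫ σ) ≫ q))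
  (hsq₂ : IsPullback j₂ t₂ ((τ ≫ σ) ≫ q) (Spec.map (CommRingCat.ofHom θ)))
  (hsets : j₂ '' closure (υ₂ ⁻¹' (T \ {pt})) = S'') [IsIntegral G'] (hT'irr : IsIrreducible (closure (υ₂ ⁻¹' (T \ {pt}))))

include hRuledIso hυ' hZ₉inf hTirr hEcl hTE hEsB hNsB hExc hExcF hyc hTy hD hυ₂ hτ hdisj hcomm hCh'' hX''reg hdom'' hsq₂ hsets hT'irr

/-- **A point step on `Tower.InvB₄` at an explicit stage step** (the core of the A‴ `(pt-reg)` / `(pt-ram)` closures; menus: `K'` as in B,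
`E'` = the NEW PLANE WITH A SUPPLIED MODEL (`hE'`'s first arm carries its `Exc₄` datum in the new stage — `(pt-reg)`: `Tower.exc₄_newPlane_of_section`),
the transported surface OFF the point, or — res-L1-w45b-lead-2's third arm (Q-E-MENU 2026-08-28T10:28:49Z, desk no objection) — the SWITCH to a retained
model-carrying member away from the point with the shadow dropped (`K' = ∅`), `Es'` = B-AWAY transports of members of `E :: Es` off the point OR the new plane with its model, `Ns'` = model-less
transports (topology only) of any member of `E :: Es ++ Ns`, or the new (possibly fat) plane). [cite: Liu2002, §8.1 and Thm. 8.1.19]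
[cite: GortzWedhorn2020, Prop. 13.91 (3) and (13.19)] [OURS · L1 W4.5b · T23-A‴ engine, brick (U2)′]; NOT a statement of the manuscript. -/
theorem Tower.invB₄_pointStep (K' E' : Set G') (Es' Ns' : List (Set G'))
    (hK' : K' = ∅ ∨ (pt ∉ closure K ∧ K' = closure (υ₂ ⁻¹' (K \ {pt}))))
    (hE' : (E' = υ₂ ⁻¹' {pt} ∧ ∀ hE'' : IsClosed (υ₂ ⁻¹' ({pt} : Set G)),
        Tower.Exc₄ O P q Y Ruled Z₉ hZ₉ υ' G' (υ₂ ≫ γ) (υ₂ ⁻¹' {pt}) hE'' ∅ X'' (τ ≫ σ) j₂) ∨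
      (pt ∉ E ∧ E' = closure (υ₂ ⁻¹' (E \ {pt}))) ∨
      (∃ F ∈ E :: Es, pt ∉ F ∧ E' = closure (υ₂ ⁻¹' (F \ {pt})) ∧ K' = ∅))
    (hEs' : ∀ F' ∈ Es', (∃ F ∈ E :: Es, pt ∉ F ∧ F' = closure (υ₂ ⁻¹' (F \ {pt}))) ∨
      (F' = υ₂ ⁻¹' {pt} ∧ ∀ hE'' : IsClosed (υ₂ ⁻¹' ({pt} : Set G)),
        Tower.Exc₄ O P q Y Ruled Z₉ hZ₉ υ' G' (υ₂ ≫ γ) (υ₂ ⁻¹' {pt}) hE'' ∅ X'' (τ ≫ σ) j₂))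
    (hNs' : ∀ F' ∈ Ns', (∃ F ∈ (E :: Es) ++ Ns, F' = closure (υ₂ ⁻¹' (F \ {pt}))) ∨ F' = υ₂ ⁻¹' {pt}) :
    Tower.InvB₄ O k θ P q Y Ch Ruled F₉ Z₉ hZ₉ F₁₀ υ' G' (υ₂ ≫ γ) (closure (υ₂ ⁻¹' (T \ {pt}))) E' Es' Ns' K' := by
  -- every member of `E :: Es`: closed, `T ⊄ F`, shadow-forgotten MODEL datum
  have hmem : ∀ F ∈ E :: Es, ∃ hF : IsClosed F, ¬ T ⊆ F ∧ Tower.Exc₄ O P q Y Ruled Z₉ hZ₉ υ' G γ F hF ∅ X σ jG := by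
    intro F hF
    rcases List.mem_cons.mp hF with rfl | hF
    · exact ⟨hEcl, hTE, Tower.exc₄_forgetShadow O P q Y Ruled (hExc hEcl)⟩
    · exact ⟨(hEsB F hF).1, (hEsB F hF).2, hExcF F hF (hEsB F hF).1⟩
  -- every member of `E :: Es ++ Ns`: closed and `T ⊄ F`
  have hmemAll : ∀ F ∈ (E :: Es) ++ Ns, IsClosed F ∧ ¬ T ⊆ F := by
    intro F hF
    rcases List.mem_append.mp hF with hF | hF
    · obtain ⟨hFcl, hTF, -⟩ := hmem F hF
      exact ⟨hFcl, hTF⟩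
    · exact hNsB F hF
  -- the pointwise ruled transports the bricks ask for
  have hRuledPt : ∀ (G₀ G₀' : Scheme.{0}) (γ₀ : G₀ ⟶ F₁₀) (E₀ : Set G₀) (X₀ X₀'' : Scheme.{0}) (σ₀ : X₀ ⟶ P) (j₀ : G₀ ⟶ X₀)
      (j₀' : G₀' ⟶ X₀'') (t₀' : G₀' ⟶ Spec (.of k)) (𝓔₀ : X₀.IdealSheafData) (τ₀ : X₀'' ⟶ X₀) (υ₀ : G₀' ⟶ G₀) (y₀ : G₀),
      j₀' ≫ τ₀ = υ₀ ≫ j₀ → IsPullback j₀' t₀' ((τ₀ ≫ σ₀) ≫ q) (Spec.map (CommRingCat.ofHom θ)) → y₀ ∉ E₀ →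
      (∃ e : (𝓔₀.comap τ₀).subscheme ≅ 𝓔₀.subscheme, e.hom ≫ 𝓔₀.subschemeι = (𝓔₀.comap τ₀).subschemeι ≫ τ₀) →
      Ruled F₉ Z₉ hZ₉ F₁₀ υ' G₀ γ₀ E₀ X₀ σ₀ j₀ 𝓔₀ →
      Ruled F₉ Z₉ hZ₉ F₁₀ υ' G₀' (υ₀ ≫ γ₀) (closure (υ₀ ⁻¹' (E₀ \ {y₀}))) X₀'' (τ₀ ≫ σ₀) j₀' (𝓔₀.comap τ₀) :=
    fun G₀ G₀' γ₀ E₀ X₀ X₀'' σ₀ j₀ j₀' _ 𝓔₀ τ₀ υ₀ y₀ _ _ _ he hR => hRuledIso G₀ G₀' γ₀ _ E₀ _ X₀ X₀'' σ₀ j₀ j₀' 𝓔₀ τ₀ he hR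
  have hRuledAway : ∀ (F : Set G) (𝓕 : X.IdealSheafData),
      (∃ e : (𝓕.comap τ).subscheme ≅ 𝓕.subscheme, e.hom ≫ 𝓕.subschemeι = (𝓕.comap τ).subschemeι ≫ τ) →
      Ruled F₉ Z₉ hZ₉ F₁₀ υ' G γ F X σ jG 𝓕 →
      Ruled F₉ Z₉ hZ₉ F₁₀ υ' G' (υ₂ ≫ γ) (closure (υ₂ ⁻¹' (F \ {pt}))) X'' (τ ≫ σ) j₂ (𝓕.comap τ) :=
    fun F 𝓕 he hR => hRuledIso G G' γ _ F _ X X'' σ jG j₂ 𝓕 τ he hR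
  -- `T' ⊄ υ₂⁻¹{pt}` (a point of `T` off `pt` lifts)
  have hTnew : ¬ closure (υ₂ ⁻¹' (T \ {pt})) ⊆ υ₂ ⁻¹' {pt} := by
    obtain ⟨t, htT, htne⟩ := Set.not_subset.mp hTy
    have htJ : t ∉ (D.support : Set G) := by rw [hD]; exact htne
    obtain ⟨t₂, ht₂⟩ := exists_preimage_of_not_mem_support υ₂ D hυ₂ htJ
    intro hsub
    have h1 : t₂ ∈ closure (υ₂ ⁻¹' (T \ {pt})) := subset_closure (by rw [Set.mem_preimage, ht₂]; exact ⟨htT, htne⟩)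
    have h2 := hsub h1
    rw [Set.mem_preimage, ht₂] at h2
    exact htne h2
  -- the model-carrying list: bookkeeping and the B-AWAY transport / the new plane's model, member by member
  have hEs'B : ∀ F' ∈ Es', IsClosed F' ∧ ¬ closure (υ₂ ⁻¹' (T \ {pt})) ⊆ F' := by
    intro F' hF'
    rcases hEs' F' hF' with ⟨F, hFmem, hptF, rfl⟩ | ⟨rfl, -⟩
    · obtain ⟨hF, hTF, -⟩ := hmem F hFmem
      exact ⟨isClosed_closure, not_closure_preimage_diff_subset hυ₂ hTirr hF hyc hTF hTy hD.le⟩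
    · exact ⟨hyc.preimage υ₂.continuous, hTnew⟩
  have hEs'Exc : ∀ F' ∈ Es', ∀ hF' : IsClosed F',
      Tower.Exc₄ O P q Y Ruled Z₉ hZ₉ υ' G' (υ₂ ≫ γ) F' hF' ∅ X'' (τ ≫ σ) j₂ := by
    intro F' hF'
    rcases hEs' F' hF' with ⟨F, hFmem, hptF, rfl⟩ | ⟨rfl, hplane⟩
    · obtain ⟨hF, -, hExcF0⟩ := hmem F hFmem
      refine Tower.exc₄_transport_away O P q Y Ruled hτ hυ₂ hD hcomm hRuledAway hF hExcF0 (Set.disjoint_singleton_left.mpr hptF) fun 𝓕 h𝓕 => hdisj 𝓕 ?_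
      intro hmemsupp
      have h1 : pt ∈ ((𝓕.comap jG).support : Set G) := by rw [support_comap]; exact hmemsupp
      rw [h𝓕, Scheme.IdealSheafData.coe_support_vanishingIdeal] at h1
      exact hptF h1
    · exact hplane
  -- the model-less list: bookkeeping only
  have hNs'B : ∀ F' ∈ Ns', IsClosed F' ∧ ¬ closure (υ₂ ⁻¹' (T \ {pt})) ⊆ F' := by
    intro F' hF'
    rcases hNs' F' hF' with ⟨F, hFmem, rfl⟩ | rfl
    · obtain ⟨hF, hTF⟩ := hmemAll F hFmem
      exact ⟨isClosed_closure, not_closure_preimage_diff_subset hυ₂ hTirr hF hyc hTF hTy hD.le⟩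
    · exact ⟨hyc.preimage υ₂.continuous, hTnew⟩
  -- the running surface
  rcases hE' with ⟨rfl, hplane⟩ | ⟨hyE, rfl⟩ | ⟨F, hFmem, hptF, rfl, rfl⟩
  rotate_right
  · -- SWITCH: the running surface becomes the transported retained member `St F` (`pt ∉ F`), shadow dropped
    obtain ⟨hF, hTF, hExcF0⟩ := hmem F hFmem
    have hTE' : ¬ closure (υ₂ ⁻¹' (T \ {pt})) ⊆ closure (υ₂ ⁻¹' (F \ {pt})) :=
      not_closure_preimage_diff_subset hυ₂ hTirr hF hyc hTF hTy hD.le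
    refine ⟨hυ', hZ₉inf, inferInstance, isClosed_closure, hT'irr, isClosed_closure, hTE', hEs'B, hNs'B, X'', τ ≫ σ, _, j₂, t₂, hCh'',
      inferInstance, inferInstance, hX''reg, hdom'', hsq₂, hsets, fun hE'' => ?_, hEs'Exc⟩
    refine Tower.exc₄_transport_away O P q Y Ruled hτ hυ₂ hD hcomm hRuledAway hF hExcF0 (Set.disjoint_singleton_left.mpr hptF)
      (fun 𝓕 h𝓕 => hdisj 𝓕 ?_) hE''
    intro hmemsupp
    have h1 : pt ∈ ((𝓕.comap jG).support : Set G) := by rw [support_comap]; exact hmemsupp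
    rw [h𝓕, Scheme.IdealSheafData.coe_support_vanishingIdeal] at h1
    exact hptF h1
  · -- NEW PLANE `E' = υ₂⁻¹{pt}` WITH ITS MODEL; shadow `∅` or the TRIVIAL cone when `K' = St K` misses the plane
    refine ⟨hυ', hZ₉inf, inferInstance, isClosed_closure, hT'irr, hyc.preimage υ₂.continuous, hTnew, hEs'B, hNs'B, X'', τ ≫ σ, _, j₂, t₂,
      hCh'', inferInstance, inferInstance, hX''reg, hdom'', hsq₂, hsets, fun hE'' => ?_, hEs'Exc⟩
    rcases hK' with rfl | ⟨hyK, rfl⟩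
    · exact hplane hE''
    · refine Tower.exc₄_shadow_of_disjoint O P q Y Ruled (hplane hE'') ?_
      rw [isClosed_closure.closure_eq]
      refine Set.disjoint_left.mpr fun z hz hzK => ?_
      have hsub : closure (υ₂ ⁻¹' (K \ {pt})) ⊆ υ₂ ⁻¹' closure K :=
        closure_minimal (fun w hw => subset_closure hw.1) (isClosed_closure.preimage υ₂.continuous)
      have h1 := hsub hzK
      rw [Set.mem_preimage] at h1 hz
      rw [Set.mem_singleton_iff] at hz
      rw [hz] at h1
      exact hyK h1
  · -- TRANSPORTED SURFACE `E' = closure υ₂⁻¹(E ∖ {pt})` (the point is OFF `E`: a model cannot be carried through a point on it)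
    have hTE' : ¬ closure (υ₂ ⁻¹' (T \ {pt})) ⊆ closure (υ₂ ⁻¹' (E \ {pt})) :=
      not_closure_preimage_diff_subset hυ₂ hTirr hEcl hyc hTE hTy hD.le
    refine ⟨hυ', hZ₉inf, inferInstance, isClosed_closure, hT'irr, isClosed_closure, hTE', hEs'B, hNs'B, X'', τ ≫ σ, _, j₂, t₂, hCh'',
      inferInstance, inferInstance, hX''reg, hdom'', hsq₂, hsets, ?_, hEs'Exc⟩
    rcases hK' with rfl | ⟨hyK, rfl⟩
    · -- shadow forgotten: forget it in the old datum, then transport with `K := ∅`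
      have hExc0 : ∀ hE : IsClosed E, Tower.Exc₄ O P q Y Ruled Z₉ hZ₉ υ' G γ E hE (∅ : Set G) X σ jG :=
        fun hE => Tower.exc₄_forgetShadow O P q Y Ruled (hExc hE)
      have h := Tower.exc₄_pointCentre_transport O k θ P q Y Ruled hEcl hExc0 hD hυ₂ hτ hdisj hcomm hsq₂ hRuledPt hyE (Or.inl rfl)
      simpa only [Set.empty_sdiff, Set.preimage_empty, closure_empty] using h
    · exact Tower.exc₄_pointCentre_transport O k θ P q Y Ruled hEcl hExc hD hυ₂ hτ hdisj hcomm hsq₂ hRuledPt hyE (Or.inr hyK)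

end PointStepCore4

/-! ## The explicit-stage `(pt-reg)` / `(pt-ram)` steps on `Tower.InvB₄` (the downstairs ₄ step predicates are wrappers over these) -/

section Steps4

variable (O : Type) [CommRing O] [IsDomain O] [IsDiscreteValuationRing O] [IsAdicComplete (maximalIdeal O) O]
  [IsAlgClosed (ResidueField O)] (k : Type) [Field k] (θ : O →+* k) (hθ : Function.Surjective θ)
  (P : Scheme.{0}) (q : P ⟶ Spec (.of O)) (Y : Set P) (hYsp : Y ⊆ q ⁻¹' {closedPoint O}) (hYirr : IsIrreducible Y)
  (hYcl : IsClosed Y) [IsProper q] [IsIntegral P] (hPnoeth : IsLocallyNoetherian P) (hPreg : Scheme.IsRegular P)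
  [SmoothOfRelativeDimension 3 q]
  (Ch : ∀ X' : Scheme.{0}, (X' ⟶ P) → Set X' → Prop)
  (hChain : ∀ (X' : Scheme.{0}) (σ : X' ⟶ P) (S : Set X'), Ch X' σ S → Chain P Y X' σ S)
  (hStep : ∀ (X' X'' : Scheme.{0}) (σ' : X' ⟶ P) (S' : Set X') (C : X'.IdealSheafData) (τ : X'' ⟶ X'),
    Ch X' σ' S' → IsBlowup τ C → Scheme.IsRegular C.subscheme → Flat (C.subschemeι ≫ σ' ≫ q) →
    σ' '' (C.support : Set X') ⊆ {x : P | ¬ IsGenericPoint x Y} →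
    (C.support : Set X') ∩ (σ' ≫ q) ⁻¹' {closedPoint O} ⊆ S' →
    Ch X'' (τ ≫ σ') (closure (τ ⁻¹' (S' \ (C.support : Set X')))))
  (Ruled : Tower.RuledDatum P) (F₉ : Scheme.{0}) (Z₉ : Set F₉) (hZ₉ : IsClosed Z₉) (F₁₀ : Scheme.{0}) (υ' : F₁₀ ⟶ F₉)
  (hRuledIso : ∀ (G₀ G₀' : Scheme.{0}) (γ₀ : G₀ ⟶ F₁₀) (γ₀' : G₀' ⟶ F₁₀) (E₀ : Set G₀) (E₀' : Set G₀') (X₀ X₀'' : Scheme.{0})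
      (σ₀ : X₀ ⟶ P) (j₀ : G₀ ⟶ X₀) (j₀' : G₀' ⟶ X₀'') (𝓔₀ : X₀.IdealSheafData) (τ₀ : X₀'' ⟶ X₀),
    (∃ e : (𝓔₀.comap τ₀).subscheme ≅ 𝓔₀.subscheme, e.hom ≫ 𝓔₀.subschemeι = (𝓔₀.comap τ₀).subschemeι ≫ τ₀) →
    Ruled F₉ Z₉ hZ₉ F₁₀ υ' G₀ γ₀ E₀ X₀ σ₀ j₀ 𝓔₀ → Ruled F₉ Z₉ hZ₉ F₁₀ υ' G₀' γ₀' E₀' X₀'' (τ₀ ≫ σ₀) j₀' (𝓔₀.comap τ₀))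

include hθ hYsp hYirr hYcl hPnoeth hPreg hChain hStep hRuledIso

omit [IsIntegral P] [SmoothOfRelativeDimension 3 q] in
/-- **THE `(pt-reg)` STEP ON `Tower.InvB₄`, THE NEW PLANE RETAINABLE WITH ITS MODEL** (explicit form of the A‴ `(pt-reg)` clause): at a closed point `pt` of the
reduced running curve where `T̃` is not regular but `G` is, blow `pt` up (`υ₂`); stage + plane model by res-L1-w45b-stub-2's `Tower.exists_ptReg_stage_planeModel`
(p624223); then `Tower.invB₄_pointStep`. The new plane `υ₂⁻¹{pt}` may be the running surface or a member of `Es'` WITH its model `(ker s)·𝒪_{X''}`, or sit in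
`Ns'`; E-menu = res-L1-w45b-lead-2's restricted ₄ menu (new plane ∨ `St E` off the point ∨ switch to a retained member off the point with `K' = ∅`). STAND-IN `hRuledBirth`: the ruled datum of the new plane's model (at `FE` it is the package's flatness clause — pass `fun _ _ _ _ _ _ _ _ h => h`).
[cite: Liu2002, §8.1 and Thm. 8.1.19] [cite: GortzWedhorn2020, Prop. 13.91 (3) and (13.19)] [OURS · L1 W4.5b · T23-A‴ engine, brick (U2)′]
toward the A‴ rung; NOT a statement of the manuscript. -/
theorem Tower.invB₄_ptRegStep
    (hRuledBirth : ∀ (G₀ G₀' : Scheme.{0}) (γ₀' : G₀' ⟶ F₁₀) (E₀' : Set G₀') (X₀ X₀'' : Scheme.{0}) (σ₀ : X₀ ⟶ P) (j₀' : G₀' ⟶ X₀'')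
        (s₀ : Spec (.of O) ⟶ X₀) (τ₀ : X₀'' ⟶ X₀),
      IsBlowup τ₀ s₀.ker → Flat ((s₀.ker.comap τ₀).subschemeι ≫ (τ₀ ≫ σ₀) ≫ q) →
      Ruled F₉ Z₉ hZ₉ F₁₀ υ' G₀' γ₀' E₀' X₀'' (τ₀ ≫ σ₀) j₀' (s₀.ker.comap τ₀))
    (G G' : Scheme.{0}) (γ : G ⟶ F₁₀) (T E : Set G) (Es Ns : List (Set G)) (K : Set G)
    (y : redSub G (closure T) isClosed_closure) (υ₂ : G' ⟶ G) (hyc : IsClosed ({curvePt G T y} : Set G))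
    (K' E' : Set G') (Es' Ns' : List (Set G'))
    (hinv : Tower.InvB₄ O k θ P q Y Ch Ruled F₉ Z₉ hZ₉ F₁₀ υ' G γ T E Es Ns K)
    (hTreg : ¬ IsRegularLocalRing ((redSub G (closure T) isClosed_closure).presheaf.stalk y))
    (hGreg : IsRegularLocalRing (G.presheaf.stalk (curvePt G T y)))
    (hυ₂ : IsBlowup υ₂ (vanishingIdeal (⟨{curvePt G T y}, hyc⟩ : Closeds G)))
    (hK' : K' = ∅ ∨ (curvePt G T y ∉ closure K ∧ K' = closure (υ₂ ⁻¹' (K \ {curvePt G T y}))))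
    (hE' : E' = υ₂ ⁻¹' {curvePt G T y} ∨ (curvePt G T y ∉ E ∧ E' = closure (υ₂ ⁻¹' (E \ {curvePt G T y}))) ∨
      (∃ F ∈ E :: Es, curvePt G T y ∉ F ∧ E' = closure (υ₂ ⁻¹' (F \ {curvePt G T y})) ∧ K' = ∅))
    (hEs' : ∀ F' ∈ Es', (∃ F ∈ E :: Es, curvePt G T y ∉ F ∧ F' = closure (υ₂ ⁻¹' (F \ {curvePt G T y}))) ∨ F' = υ₂ ⁻¹' {curvePt G T y})
    (hNs' : ∀ F' ∈ Ns', (∃ F ∈ (E :: Es) ++ Ns, F' = closure (υ₂ ⁻¹' (F \ {curvePt G T y}))) ∨ F' = υ₂ ⁻¹' {curvePt G T y}) :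
    Tower.InvB₄ O k θ P q Y Ch Ruled F₉ Z₉ hZ₉ F₁₀ υ' G' (υ₂ ≫ γ) (closure (υ₂ ⁻¹' (T \ {curvePt G T y}))) E' Es' Ns' K' := by
  classical
  obtain ⟨hυ', hZ₉inf, hGint, hTcl, hTirr, hEcl, hTE, hEsB, hNsB, X, σ, S, jG, tG, hCh, hXint, hXnoeth, hXreg, hdom, hsq, hTS, hExc, hExcF⟩ :=
    hinv
  haveI := hGint
  haveI := hXint
  haveI := hXnoeth
  have hyT : curvePt G T y ∈ T := subschemeι_mem_of_isClosed hTcl y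
  have hTy : ¬ T ⊆ {curvePt G T y} := not_subset_singleton_of_not_isRegularLocalRing_stalk y hTreg hyc
  -- the stage step WITH the plane model (res-L1-w45b-stub-2)
  obtain ⟨s, X'', τ, j₂, t₂, hs, hss₀, hτ, hsreg, hsflat, hCD, hsoff, hCb, hdisj, hCh'', hreg'', hnoeth'', hint'', hdom'', hG'int, hT'irr, hGnoeth,
      hsq₂, hcomm, -, -, hEi, hEii, hEiii, hEiv, hEfe, -⟩ :=
    Tower.exists_ptReg_stage_planeModel O k θ hθ P q Y hYsp hYirr hYcl hPnoeth hPreg Ch hChain hStep X σ S hCh hXreg hdom G jG tG hsq T hTS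
      (curvePt G T y) hyc hyT hTy hGreg G' υ₂ hυ₂
  haveI := hnoeth''
  haveI := hint''
  haveI := hG'int
  haveI := hGnoeth
  -- the new plane's `Exc₄` datum in the new stage (shadow forgotten)
  have hplane : ∀ hE'' : IsClosed (υ₂ ⁻¹' ({curvePt G T y} : Set G)),
      Tower.Exc₄ O P q Y Ruled Z₉ hZ₉ υ' G' (υ₂ ≫ γ) (υ₂ ⁻¹' {curvePt G T y}) hE'' ∅ X'' (τ ≫ σ) j₂ := fun hE'' =>
    ⟨s.ker.comap τ, hEi hE'', hEii, hEiii, hEiv, hRuledBirth G G' (υ₂ ≫ γ) _ X X'' σ j₂ s τ hτ hEfe, Or.inl rfl⟩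
  subst hTS
  have hD : ((vanishingIdeal (⟨{curvePt G T y}, hyc⟩ : Closeds G) : G.IdealSheafData).support : Set G) = {curvePt G T y} :=
    Scheme.IdealSheafData.coe_support_vanishingIdeal _
  refine Tower.invB₄_pointStep O k θ P q Y Ch Ruled hRuledIso hυ' hZ₉inf hTirr hEcl hTE hEsB hNsB hExc hExcF hyc hTy hD hυ₂ hτ hdisj hcomm
    hCh'' hreg'' hdom'' hsq₂ rfl hT'irr K' E' Es' Ns' hK' ?_ ?_ hNs'
  · rcases hE' with h | h | h
    · exact Or.inl ⟨h, hplane⟩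
    · exact Or.inr (Or.inl h)
    · exact Or.inr (Or.inr h)
  · intro F' hF'
    rcases hEs' F' hF' with h | h
    · exact Or.inl h
    · exact Or.inr ⟨h, hplane⟩

/-- **THE `(pt-ram)` STEP ON `Tower.InvB₄`** (explicit form of the A‴ `(pt-ram)` clause): at a closed point where NEITHER `T̃` NOR `G` is regular, blow up the
curvilinear fat point `J` (`fatPointStep_model`, res-L1-w45b-stub-4 …NatTowerPtStepsInvThree: the fat point lifts to a regular `O`-flat multisection); the FAT
plane `υ₂⁻¹{pt}` has no reduced model and may enter `Ns'` only; the running surface is `St E` off the point or switches to a retained member off the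
point (`K' = ∅`), the members of `Es` are transported OFF the point; then `Tower.invB₄_pointStep`. [cite: Liu2002, §8.1 and Thm. 8.1.19] [cite: GortzWedhorn2020, Prop. 13.91 (3) and (13.19)] [OURS · L1 W4.5b · T23-A‴ engine, brick (U2)′];
NOT a statement of the manuscript. -/
theorem Tower.invB₄_ptRamStep
    (G G' : Scheme.{0}) (γ : G ⟶ F₁₀) (T E : Set G) (Es Ns : List (Set G)) (K : Set G)
    (y : redSub G (closure T) isClosed_closure) (J : G.IdealSheafData) (υ₂ : G' ⟶ G)
    (K' E' : Set G') (Es' Ns' : List (Set G'))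
    (hinv : Tower.InvB₄ O k θ P q Y Ch Ruled F₉ Z₉ hZ₉ F₁₀ υ' G γ T E Es Ns K)
    (hTreg : ¬ IsRegularLocalRing ((redSub G (closure T) isClosed_closure).presheaf.stalk y))
    (hJsupp : (J.support : Set G) = {curvePt G T y})
    (hJgen : ∃ (ℓ : Fin 3 → G.presheaf.stalk (curvePt G T y)) (hℓ : ∀ i, ℓ i ∈ maximalIdeal (G.presheaf.stalk (curvePt G T y))),
      stalkIdeal J (curvePt G T y) = Ideal.span (Set.range ℓ) ∧
      LinearIndependent (ResidueField (G.presheaf.stalk (curvePt G T y)))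
        (fun i => (maximalIdeal (G.presheaf.stalk (curvePt G T y))).toCotangent ⟨ℓ i, hℓ i⟩))
    (hυ₂ : IsBlowup υ₂ J)
    (hK' : K' = ∅ ∨ (curvePt G T y ∉ closure K ∧ K' = closure (υ₂ ⁻¹' (K \ {curvePt G T y}))))
    (hE' : (curvePt G T y ∉ E ∧ E' = closure (υ₂ ⁻¹' (E \ {curvePt G T y}))) ∨
      (∃ F ∈ E :: Es, curvePt G T y ∉ F ∧ E' = closure (υ₂ ⁻¹' (F \ {curvePt G T y})) ∧ K' = ∅))
    (hEs' : ∀ F' ∈ Es', ∃ F ∈ E :: Es, curvePt G T y ∉ F ∧ F' = closure (υ₂ ⁻¹' (F \ {curvePt G T y})))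
    (hNs' : ∀ F' ∈ Ns', (∃ F ∈ (E :: Es) ++ Ns, F' = closure (υ₂ ⁻¹' (F \ {curvePt G T y}))) ∨ F' = υ₂ ⁻¹' {curvePt G T y}) :
    Tower.InvB₄ O k θ P q Y Ch Ruled F₉ Z₉ hZ₉ F₁₀ υ' G' (υ₂ ≫ γ) (closure (υ₂ ⁻¹' (T \ {curvePt G T y}))) E' Es' Ns' K' := by
  classical
  obtain ⟨hυ', hZ₉inf, hGint, hTcl, hTirr, hEcl, hTE, hEsB, hNsB, X, σ, S, jG, tG, hCh, hXint, hXnoeth, hXreg, hdom, hsq, hTS, hExc, hExcF⟩ :=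
    hinv
  haveI := hGint
  haveI := hXint
  haveI := hXnoeth
  have hyT : curvePt G T y ∈ T := subschemeι_mem_of_isClosed hTcl y
  have hyc : IsClosed ({curvePt G T y} : Set G) := hJsupp ▸ J.support.isClosed
  have hTy : ¬ T ⊆ {curvePt G T y} := not_subset_singleton_of_not_isRegularLocalRing_stalk y hTreg hyc
  haveI : IsClosedImmersion (Spec.map (CommRingCat.ofHom θ)) := IsClosedImmersion.spec_of_surjective _ hθ
  haveI hjci : IsClosedImmersion jG := MorphismProperty.IsStableUnderBaseChange.of_isPullback hsq.flip inferInstance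
  have hjyc : IsClosed ({jG (curvePt G T y)} : Set X) := by
    simpa only [Set.image_singleton] using hjci.isClosedEmbedding.isClosedMap _ hyc
  have hyoff : ¬ IsGenericPoint (σ (jG (curvePt G T y))) Y :=
    not_isGenericPoint_of_image_eq (hChain _ _ _ hCh) jG hjci.isClosedEmbedding.injective hTS hjyc hTy
  obtain ⟨ℓ, hℓ, hJℓ, hli⟩ := hJgen
  obtain ⟨C, X'', τ, j₂, t₂, hτ, -, -, -, -, hdisj, hCh'', hreg'', hnoeth'', hint'', hdom'', -, -, hGnoeth, hG'int, -, hT'irr,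
      hsq₂, hcomm, hsets⟩ :=
    fatPointStep_model O k θ hθ P q Y hYsp hYirr hYcl hPnoeth hPreg 3 Ch hChain hStep X σ S hCh hdom G jG tG hsq T hTS
      (curvePt G T y) hyT hTy hyoff J hJsupp ℓ hℓ hJℓ hli G' υ₂ hυ₂
  haveI := hGnoeth
  haveI := hnoeth''
  haveI := hint''
  haveI := hG'int
  subst hTS
  exact Tower.invB₄_pointStep O k θ P q Y Ch Ruled hRuledIso hυ' hZ₉inf hTirr hEcl hTE hEsB hNsB hExc hExcF hyc hTy hJsupp hυ₂ hτ hdisj hcomm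
    hCh'' hreg'' hdom'' hsq₂ hsets hT'irr K' E' Es' Ns' hK' (Or.inr hE') (fun F' hF' => Or.inl (hEs' F' hF')) hNs'

end Steps4

end Summit.ResolutionOfSingularities.ResolutionOfSingularities.Cruxes.EquisingularLiftNat.Sections

end
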